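import Literature.MathematicalPhysics.QuantumFieldTheory.Balaban1983to89.T4TriangularPushforward

/-!
# Route `UnitScaleTilt` — crux K1bR-pr `FluctuationComparisonRegPr` (stmt-QuantumFields-19201), «Lemma B» line, step S-B1:
# THE FIBREWISE SUBMERSION ENGINE — an open map that is measure-open, from ROBUST LOCAL SURJECTIVITY and REVERSE ABSOLUTE
# CONTINUITY of the ONE-VARIABLE LAWS in private coordinates (support file `--supports stmt-QuantumFields-19201`; abstract measure theory)

Fleet lead `ym-ust-19201-p1` (gen 0).  The landed reduction `PosOnSmallReduction.posOnSmall_of_smallLift_of_oneStepSubmersion` (p443013) leaves,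
besides the small lift, two LOCAL properties of ONE (0.4) averaging step `A = avgFun ℰp : (ι → G) → (κ → G)` on open subsets `O` of the
small fields: (O) `A(O)` is open; (N) `μ^ι(O ∩ A⁻¹N) = 0 ⇒ μ^κ(N ∩ A(O)) = 0` (`N` measurable).  THIS FILE proves (O) ∧ (N) for an ABSTRACT
map `A` with PRIVATE COORDINATES `β : κ ↪ ι` (`T4TriangularPushforward.IsLocal β A`: the output at `c′ ≠ c` does not see the input at `β c` —
for (0.4) this is FACT (A) of `BlockAveragingHaarAC`, `β` = the central crossing bond) from a FIBREWISE hypothesis on the one-variable maps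
`f_c^U : g ↦ A (update U (β c) g) c` at the points of a region `D ⊇ O`:

  (FIB) for every `V₀ ∈ D` and all neighbourhoods `𝒰₁ ∋ V₀`, `B₁ c ∋ V₀(β c)` there are a smaller open `𝒰 ∋ V₀`, sets `B c ⊆ B₁ c` through
  `V₀(β c)` and OPEN `W c ∋ (A V₀) c` such that for EVERY environment `U ∈ 𝒰` and every `c`:
  `W c ⊆ f_c^U(B c)` (robust local surjectivity) and `μ|_{W c} ≪ (f_c^U)_*(μ|_{B c})` (reverse absolute continuity of the one-variable law).

For a `C¹` one-variable law with invertible differential, continuous in the environment, (FIB) is the inverse function theorem with a parameter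
plus Lusin's property (N) (step S-B2, the `SU(2)` analysis of `W ↦ exp(Σ_k |I|⁻¹ log(h_k W*))·W` in the cone picture of `T4HaarSU2LocalDiffeo`).

THE ARGUMENT (`isOpen_image_and_measureOpen_of_fibrewise`).  RESAMPLING (`T4TriangularPushforward.measurePreserving_resample`,
`apply_resample_eq`): `res (U, g) := extend β g U` is measure preserving `μ^ι ⊗ μ^κ → μ^ι` and `A (res (U, g)) = Φ_U g := (c ↦ f_c^U (g c))`, a
PRODUCT map.  Given `V₀ ∈ O`, shrink to `𝒰₁ × ΠB₁ ⊆ res⁻¹O` and take `𝒰, B, W` from (FIB).  (O): every `z` in the open box `ΠW ∋ A V₀` is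
`Φ_{V₀} g` for some `g ∈ ΠB`, i.e. `z = A (res (V₀, g)) ∈ A(O)`.  (N): `μ^ι(O ∩ A⁻¹N) = 0` ⇒ (resampling + Fubini) for `μ^ι`-a.e. `U`,
`μ^κ{g : res (U, g) ∈ O, Φ_U g ∈ N} = 0`; as `μ^ι(𝒰) > 0` (`IsOpenPosMeasure`) SOME `U ∈ 𝒰` qualifies, whence `(Φ_U)_*(μ^κ|_{ΠB})(N) = 0`; but
`(Φ_U)_*(μ^κ|_{ΠB}) = ⊗_c (f_c^U)_*(μ|_{B c}) ≫ ⊗_c μ|_{W c} = μ^κ|_{ΠW}` (`Measure.pi_map_pi`, `restrict_pi_pi`, `pi_absolutelyContinuous_pi`), so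
`μ^κ(N ∩ ΠW) = 0`.  Countably many boxes `ΠW` cover `A(O)` (second countability), so `μ^κ(N ∩ A(O)) = 0`.
Every declaration is [folklore] measure theory; nothing of Bałaban's is asserted.
-/

noncomputable section

open MeasureTheory Set Function Filter Topology
open Literature.MathematicalPhysics.QuantumFieldTheory.Balaban1983to89.T4TriangularPushforward

namespace Summit.QuantumFields.YangMills.Theorems.FibrewiseSubmersion

variable {ι κ G : Type*} [Fintype ι] [Fintype κ] [DecidableEq ι]
  [MeasurableSpace G] [TopologicalSpace G] [SecondCountableTopology G] [OpensMeasurableSpace G]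
  (μ : Measure G) [IsProbabilityMeasure μ] [μ.IsOpenPosMeasure]
  {β : κ → ι} {A : (ι → G) → (κ → G)}

omit [Fintype ι] [MeasurableSpace G] [TopologicalSpace G] [SecondCountableTopology G] [OpensMeasurableSpace G] in
/-- Resampling a configuration by its own private coordinates changes nothing: `extend β (V ∘ β) V = V`. [folklore] -/
theorem extend_comp_self (hβ : Injective β) (V : ι → G) : extend β (fun c => V (β c)) V = V := by
  funext i
  by_cases hi : ∃ c, β c = i
  · obtain ⟨c, rfl⟩ := hi
    exact hβ.extend_apply _ _ _
  · exact extend_apply' _ _ _ hi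

omit [Fintype ι] [Fintype κ] [DecidableEq ι] [MeasurableSpace G] [SecondCountableTopology G] [OpensMeasurableSpace G] in
/-- The resampling map `(U, g) ↦ extend β g U` is continuous (coordinatewise a projection). [folklore] -/
theorem continuous_resample (hβ : Injective β) : Continuous (fun p : (ι → G) × (κ → G) => extend β p.2 p.1) := by
  refine continuous_pi fun i => ?_
  by_cases hi : ∃ c, β c = i
  · obtain ⟨c, rfl⟩ := hi
    have : (fun p : (ι → G) × (κ → G) => extend β p.2 p.1 (β c)) = fun p => p.2 c :=
      funext fun p => hβ.extend_apply _ _ _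
    rw [this]
    exact (continuous_apply c).comp continuous_snd
  · have : (fun p : (ι → G) × (κ → G) => extend β p.2 p.1 i) = fun p => p.1 i :=
      funext fun p => extend_apply' _ _ _ hi
    rw [this]
    exact (continuous_apply i).comp continuous_fst

/-- **THE FIBREWISE SUBMERSION ENGINE.**  Let `A : (ι → G) → (κ → G)` be measurable with private coordinates `β` (`IsLocal β A`, `β`
injective), `μ` a probability measure on `G` charging open sets, and suppose the fibrewise hypothesis (FIB) of the module docstring on a
region `D`.  Then for every open `O ⊆ D`: the image `A(O)` is OPEN, and `A` is MEASURE-OPEN on `O` — for measurable `N`,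
`μ^ι(O ∩ A⁻¹N) = 0 ⇒ μ^κ(N ∩ A(O)) = 0`. [folklore] -/
theorem isOpen_image_and_measureOpen_of_fibrewise (hA : IsLocal β A) (hβ : Injective β) (hAm : Measurable A)
    {D : Set (ι → G)}
    (hfib : ∀ V₀ ∈ D, ∀ 𝒰₁ : Set (ι → G), IsOpen 𝒰₁ → V₀ ∈ 𝒰₁ →
      ∀ B₁ : κ → Set G, (∀ c, IsOpen (B₁ c) ∧ V₀ (β c) ∈ B₁ c) →
        ∃ 𝒰 : Set (ι → G), IsOpen 𝒰 ∧ V₀ ∈ 𝒰 ∧ 𝒰 ⊆ 𝒰₁ ∧ ∃ B W : κ → Set G,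
          (∀ c, V₀ (β c) ∈ B c ∧ B c ⊆ B₁ c ∧ IsOpen (W c) ∧ A V₀ c ∈ W c) ∧
          ∀ U ∈ 𝒰, ∀ c, W c ⊆ (fun g => A (update U (β c) g) c) '' (B c) ∧
            μ.restrict (W c) ≪ (μ.restrict (B c)).map (fun g => A (update U (β c) g) c))
    {O : Set (ι → G)} (hO : IsOpen O) (hOD : O ⊆ D) :
    IsOpen (A '' O) ∧ ∀ N : Set (κ → G), MeasurableSet N →
      Measure.pi (fun _ : ι => μ) (O ∩ A ⁻¹' N) = 0 → Measure.pi (fun _ : κ => μ) (N ∩ A '' O) = 0 := by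
  -- the local claim at a point of `O`: an open box around `A V₀` inside `A(O)` on which null sets transfer
  have key : ∀ V₀ ∈ O, ∃ W : κ → Set G, (∀ c, IsOpen (W c) ∧ A V₀ c ∈ W c) ∧ Set.univ.pi W ⊆ A '' O ∧
      ∀ N : Set (κ → G), MeasurableSet N → Measure.pi (fun _ : ι => μ) (O ∩ A ⁻¹' N) = 0 →
        Measure.pi (fun _ : κ => μ) (N ∩ Set.univ.pi W) = 0 := by
    intro V₀ hV₀
    set res : (ι → G) × (κ → G) → (ι → G) := fun p => extend β p.2 p.1 with hres
    set g₀ : κ → G := fun c => V₀ (β c) with hg₀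
    have hresV₀ : res (V₀, g₀) = V₀ := extend_comp_self hβ V₀
    -- shrink to a product neighbourhood inside `res⁻¹ O`
    have hpre : IsOpen (res ⁻¹' O) := (continuous_resample hβ).isOpen_preimage O hO
    have hmem : (V₀, g₀) ∈ res ⁻¹' O := by
      show res (V₀, g₀) ∈ O
      rw [hresV₀]; exact hV₀
    obtain ⟨𝒰₁, 𝒱₁, h𝒰₁, h𝒱₁, hV𝒰₁, hg𝒱₁, hprod⟩ := isOpen_prod_iff.mp hpre V₀ g₀ hmem
    obtain ⟨B₁, hB₁, hB₁𝒱⟩ := isOpen_pi_iff'.mp h𝒱₁ g₀ hg𝒱₁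
    obtain ⟨𝒰, h𝒰, hV𝒰, h𝒰𝒰₁, B, W, hBW, hU⟩ := hfib V₀ (hOD hV₀) 𝒰₁ h𝒰₁ hV𝒰₁ B₁ hB₁
    -- environments in `𝒰` with private coordinates in `ΠB` are configurations of `O`
    have hresO : ∀ U ∈ 𝒰, ∀ g ∈ Set.univ.pi B, res (U, g) ∈ O := by
      intro U hU' g hg
      have h1 : (U, g) ∈ 𝒰₁ ×ˢ 𝒱₁ :=
        ⟨h𝒰𝒰₁ hU', hB₁𝒱 fun c _ => (hBW c).2.1 (hg c (Set.mem_univ c))⟩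
      exact hprod h1
    -- `A ∘ res` is the product map of the one-variable laws
    have hΦ : ∀ (U : ι → G) (g : κ → G), A (res (U, g)) = fun c => A (update U (β c) (g c)) c :=
      fun U g => funext fun c => apply_resample_eq hA hβ U g c
    refine ⟨W, fun c => ⟨(hBW c).2.2.1, (hBW c).2.2.2⟩, ?_, ?_⟩
    · -- (O): the box is inside the image
      intro z hz
      have hsurj := fun c => (hU V₀ hV𝒰 c).1 (hz c (Set.mem_univ c))
      choose g hgB hgz using hsurj
      refine ⟨res (V₀, g), hresO V₀ hV𝒰 g (fun c _ => hgB c), ?_⟩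
      rw [hΦ]
      funext c
      exact hgz c
    · -- (N): null sets transfer to the box
      intro N hN hnull
      have hS : MeasurableSet (O ∩ A ⁻¹' N) := hO.measurableSet.inter (hAm hN)
      have hmp := measurePreserving_resample μ hβ (ι := ι) (κ := κ)
      have h0 : ((Measure.pi fun _ : ι => μ).prod (Measure.pi fun _ : κ => μ)) (res ⁻¹' (O ∩ A ⁻¹' N)) = 0 := by
        rw [hmp.measure_preimage hS.nullMeasurableSet]; exact hnull
      have hae := Measure.measure_ae_null_of_prod_null h0
      -- some environment in `𝒰` is good
      have hpos : 0 < Measure.pi (fun _ : ι => μ) 𝒰 := h𝒰.measure_pos _ ⟨V₀, hV𝒰⟩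
      obtain ⟨U, hU𝒰, hUgood⟩ : ∃ U ∈ 𝒰,
          Measure.pi (fun _ : κ => μ) (Prod.mk U ⁻¹' (res ⁻¹' (O ∩ A ⁻¹' N))) = 0 := by
        by_contra hcon
        simp only [not_exists, not_and] at hcon
        have hsub : 𝒰 ⊆ {U | ¬ Measure.pi (fun _ : κ => μ) (Prod.mk U ⁻¹' (res ⁻¹' (O ∩ A ⁻¹' N))) = 0} :=
          fun U hU' => hcon U hU'
        have hbad : Measure.pi (fun _ : ι => μ)
            {U | ¬ Measure.pi (fun _ : κ => μ) (Prod.mk U ⁻¹' (res ⁻¹' (O ∩ A ⁻¹' N))) = 0} = 0 :=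
          ae_iff.mp hae
        exact hpos.ne' (measure_mono_null hsub hbad)
      -- the product map of the one-variable laws of `U`
      set Φ : (κ → G) → (κ → G) := fun g c => A (update U (β c) (g c)) c with hΦdef
      have hfm : ∀ c, Measurable fun g : G => A (update U (β c) g) c :=
        fun c => (measurable_pi_apply c).comp (hAm.comp (measurable_update U))
      have hΦm : Measurable Φ := measurable_pi_lambda _ fun c => (hfm c).comp (measurable_pi_apply c)
      have hsub : Set.univ.pi B ∩ Φ ⁻¹' N ⊆ Prod.mk U ⁻¹' (res ⁻¹' (O ∩ A ⁻¹' N)) := by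
        rintro g ⟨hgB, hgN⟩
        refine ⟨hresO U hU𝒰 g hgB, ?_⟩
        show A (res (U, g)) ∈ N
        rw [hΦ]; exact hgN
      have h1 : Measure.pi (fun _ : κ => μ) (Set.univ.pi B ∩ Φ ⁻¹' N) = 0 := measure_mono_null hsub hUgood
      have h2 : ((Measure.pi fun _ : κ => μ).restrict (Set.univ.pi B)).map Φ N = 0 := by
        rw [Measure.map_apply hΦm hN, Measure.restrict_apply (hΦm hN), Set.inter_comm]; exact h1
      have h3 : ((Measure.pi fun _ : κ => μ).restrict (Set.univ.pi B)).map Φ =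
          Measure.pi fun c => (μ.restrict (B c)).map fun g => A (update U (β c) g) c := by
        rw [Measure.restrict_pi_pi]
        exact Measure.pi_map_pi fun c => (hfm c).aemeasurable
      rw [h3] at h2
      have hac : Measure.pi (fun c => μ.restrict (W c)) ≪
          Measure.pi fun c => (μ.restrict (B c)).map fun g => A (update U (β c) g) c :=
        pi_absolutelyContinuous_pi fun c => (hU U hU𝒰 c).2
      have h4 := hac h2
      rw [← Measure.restrict_pi_pi, Measure.restrict_apply hN] at h4
      exact h4
  refine ⟨?_, fun N hN hnull => ?_⟩
  · -- (O)
    rw [isOpen_iff_forall_mem_open]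
    rintro z ⟨V₀, hV₀, rfl⟩
    obtain ⟨W, hW, hWO, -⟩ := key V₀ hV₀
    exact ⟨Set.univ.pi W, hWO, isOpen_set_pi Set.finite_univ fun c _ => (hW c).1, fun c _ => (hW c).2⟩
  · -- (N): countably many boxes cover the image
    choose W hW hWO hWN using key
    have hcover : A '' O ⊆ ⋃ v : O, Set.univ.pi (W v.1 v.2) := by
      rintro z ⟨V₀, hV₀, rfl⟩
      exact Set.mem_iUnion.mpr ⟨⟨V₀, hV₀⟩, fun c _ => (hW V₀ hV₀ c).2⟩
    obtain ⟨T, hTc, hTU⟩ := TopologicalSpace.isOpen_iUnion_countable (fun v : O => Set.univ.pi (W v.1 v.2))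
      fun v => isOpen_set_pi Set.finite_univ fun c _ => (hW v.1 v.2 c).1
    rw [← hTU] at hcover
    have hle : N ∩ A '' O ⊆ ⋃ v ∈ T, (N ∩ Set.univ.pi (W v.1 v.2)) := by
      rintro z ⟨hzN, hzO⟩
      obtain ⟨v, hv⟩ := Set.mem_iUnion.mp (hcover hzO)
      obtain ⟨hvT, hzv⟩ := Set.mem_iUnion.mp hv
      exact Set.mem_biUnion hvT ⟨hzN, hzv⟩
    refine measure_mono_null hle ?_
    rw [measure_biUnion_null_iff hTc]
    intro v _
    exact hWN v.1 v.2 N hN hnull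

end Summit.QuantumFields.YangMills.Theorems.FibrewiseSubmersion

end
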